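import Summits.QuantumFields.YangMills.Theorems.AlphaInputsT3ACv3LinearLiftFlux
import HarnessLib

/-!
# `AlphaInputsT3ACv3LinearLiftFluxCocycle` — «FLUX-ROUND»: THE LATTICE BIANCHI IDENTITY AND THE INTEGER COCYCLE OF AN ALMOST-INTEGER CURL — cell `ym3-torus`, width seat
# `ym-ust-20520-w5` (g8), line «SYM-CENTRE» (EX cure (ii-a)), companion of ✓`AlphaInputsT3ACv3LinearLiftFlux` («FLUX-LIFT», p675255)

WHY.  The (R4) assembly (px20 g2) reads the angles `θ` of the diagonalised coarse field; its lattice curl is `2π·m + φ` with `φ` small and `m` INTEGER.  To split off the flux by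
✓`exists_fluxLift` one needs `m` to be a 2-COCYCLE (the cube identity) — which it inherits from the lattice BIANCHI identity of `curl θ` as soon as `6·sup|φ| < 2π` — and
antisymmetric with zero diagonal.  THIS FILE: §1 ★`curlAt_cube` — the Bianchi identity `Σ_{faces of a cube} ±curl a = 0` for EVERY real one-form (pure bookkeeping: the twelve bond
values cancel in pairs once `(x+e_μ)+e_ν = (x+e_ν)+e_μ`); §2 ★`int_cube_of_near_curl` — if `|curl θ(x;μν) − 2π·m(x;μν)| ≤ φ₀` at the six faces and `6φ₀ < 2π` then the integers
satisfy the same cube identity; `int_antisymm_of_near_curl`, `int_diag_of_near_curl` — antisymmetry and zero diagonal of `m` under `2φ₀ < 2π` ∕ `φ₀ < 2π`.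
WHAT IS NOT HERE.  The class decomposition `m = Σ q_{μν}E_{μν} + δs` («ZCLASS»), the construction of `θ` and `m` from the `SU(2)` field (R4-DICT ∕ the assembly).  Count-neutral helper
(`--supports stmt-QuantumFields-19200 --as helper`); def-free; registry and every landed file untouched.  YM₃ on the torus is a RUNG (R3), not the Clay problem; no claim about d = 4,
infinite volume or a mass gap; nothing of the stub ∕ crux is claimed.

References: T. Bałaban, Commun. Math. Phys. 98 (1985) 17–51 [Balaban1985Averaging] ((9) p.19: lattice curl; the Bianchi identity is its immediate bookkeeping); Commun. Math. Phys. 109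
(1987) 249–301 [Balaban1987RG1] ((0.1) p.251: the tori).
-/

set_option autoImplicit false

noncomputable section

namespace Summit.QuantumFields.YangMills.Theorems.LinearLiftFlux

open Literature.MathematicalPhysics.QuantumFieldTheory.Balaban1983to89
open Literature.MathematicalPhysics.QuantumFieldTheory.Balaban1983to89.BlockAveragingEMLProp2 (shift_shift_comm)
open Summit.QuantumFields.YangMills.Theorems.AbelianEML

variable {P : Params} {j : ℕ}

/-! ## §1 The lattice Bianchi identity -/

/-- **★ THE LATTICE BIANCHI IDENTITY** (`d(curl a) = 0` on every elementary cube): `[curl a(x;μν) − curl a(x+e_λ;μν)] + [curl a(x;νλ) − curl a(x+e_μ;νλ)] +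
[curl a(x;λμ) − curl a(x+e_ν;λμ)] = 0`. [cite: Balaban1985Averaging, (9) p.19] -/
theorem curlAt_cube (a : PBond P j → ℝ) (x : Site P j) (μ ν lam : Fin P.d) :
    (curlAt a x μ ν - curlAt a (x.shift lam) μ ν) + (curlAt a x ν lam - curlAt a (x.shift μ) ν lam) +
      (curlAt a x lam μ - curlAt a (x.shift ν) lam μ) = 0 := by
  simp only [curlAt]
  rw [shift_shift_comm x lam μ, shift_shift_comm x ν lam, shift_shift_comm x μ ν]
  ring

/-! ## §2 The integer part of an almost-integer curl -/

/-- An integer of absolute value `< 1` (read in `ℝ`) is zero. [folklore] -/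
theorem int_eq_zero_of_abs_lt_one {n : ℤ} (h : |(n : ℝ)| < 1) : n = 0 := by
  have h1 : ((|n| : ℤ) : ℝ) < 1 := by push_cast; exact h
  have h2 : |n| < 1 := by exact_mod_cast h1
  rw [abs_lt] at h2
  omega

/-- **★ THE INTEGER PART IS A COCYCLE**: if `|curl θ(·;··) − 2π·m(·;··)| ≤ φ₀` at the six faces of the cube at `x` in the directions `μ, ν, λ` and `6φ₀ < 2π`, then the integers `m`
satisfy the cube identity. [cite: Balaban1985Averaging, (9) p.19] -/
theorem int_cube_of_near_curl (θ : PBond P j → ℝ) (m : Site P j → Fin P.d → Fin P.d → ℤ) {φ₀ : ℝ} (hφ : 6 * φ₀ < 2 * Real.pi)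
    (x : Site P j) (μ ν lam : Fin P.d)
    (h1 : |curlAt θ x μ ν - 2 * Real.pi * m x μ ν| ≤ φ₀) (h2 : |curlAt θ (x.shift lam) μ ν - 2 * Real.pi * m (x.shift lam) μ ν| ≤ φ₀)
    (h3 : |curlAt θ x ν lam - 2 * Real.pi * m x ν lam| ≤ φ₀) (h4 : |curlAt θ (x.shift μ) ν lam - 2 * Real.pi * m (x.shift μ) ν lam| ≤ φ₀)
    (h5 : |curlAt θ x lam μ - 2 * Real.pi * m x lam μ| ≤ φ₀) (h6 : |curlAt θ (x.shift ν) lam μ - 2 * Real.pi * m (x.shift ν) lam μ| ≤ φ₀) :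
    (m x μ ν - m (x.shift lam) μ ν) + (m x ν lam - m (x.shift μ) ν lam) + (m x lam μ - m (x.shift ν) lam μ) = 0 := by
  have hB := curlAt_cube θ x μ ν lam
  have hπ := Real.pi_pos
  apply int_eq_zero_of_abs_lt_one
  push_cast
  -- `2π·(integer combination) = −(sum of the six defects)` since the six curls cancel
  set M : ℝ := ((m x μ ν : ℝ) - m (x.shift lam) μ ν) + ((m x ν lam : ℝ) - m (x.shift μ) ν lam) + ((m x lam μ : ℝ) - m (x.shift ν) lam μ) with hM
  have key : 2 * Real.pi * M =
      -((curlAt θ x μ ν - 2 * Real.pi * m x μ ν) - (curlAt θ (x.shift lam) μ ν - 2 * Real.pi * m (x.shift lam) μ ν)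
        + (curlAt θ x ν lam - 2 * Real.pi * m x ν lam) - (curlAt θ (x.shift μ) ν lam - 2 * Real.pi * m (x.shift μ) ν lam)
        + (curlAt θ x lam μ - 2 * Real.pi * m x lam μ) - (curlAt θ (x.shift ν) lam μ - 2 * Real.pi * m (x.shift ν) lam μ)) := by
    rw [hM]; linarith
  have hbound : |2 * Real.pi * M| ≤ 6 * φ₀ := by
    rw [key, abs_neg]
    have t1 := abs_sub _ _ |>.trans (add_le_add h1 h2)
    calc _ ≤ |(curlAt θ x μ ν - 2 * Real.pi * ↑(m x μ ν)) - (curlAt θ (x.shift lam) μ ν - 2 * Real.pi * ↑(m (x.shift lam) μ ν))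
              + (curlAt θ x ν lam - 2 * Real.pi * ↑(m x ν lam)) - (curlAt θ (x.shift μ) ν lam - 2 * Real.pi * ↑(m (x.shift μ) ν lam))
              + (curlAt θ x lam μ - 2 * Real.pi * ↑(m x lam μ))| + |curlAt θ (x.shift ν) lam μ - 2 * Real.pi * ↑(m (x.shift ν) lam μ)| := abs_sub _ _
      _ ≤ (|(curlAt θ x μ ν - 2 * Real.pi * ↑(m x μ ν)) - (curlAt θ (x.shift lam) μ ν - 2 * Real.pi * ↑(m (x.shift lam) μ ν))
              + (curlAt θ x ν lam - 2 * Real.pi * ↑(m x ν lam)) - (curlAt θ (x.shift μ) ν lam - 2 * Real.pi * ↑(m (x.shift μ) ν lam))|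
              + |curlAt θ x lam μ - 2 * Real.pi * ↑(m x lam μ)|) + φ₀ := by gcongr; exact abs_add_le _ _
      _ ≤ ((|(curlAt θ x μ ν - 2 * Real.pi * ↑(m x μ ν)) - (curlAt θ (x.shift lam) μ ν - 2 * Real.pi * ↑(m (x.shift lam) μ ν))
              + (curlAt θ x ν lam - 2 * Real.pi * ↑(m x ν lam))| + |curlAt θ (x.shift μ) ν lam - 2 * Real.pi * ↑(m (x.shift μ) ν lam)|) + φ₀) + φ₀ := by
            gcongr; exact abs_sub _ _
      _ ≤ (((|(curlAt θ x μ ν - 2 * Real.pi * ↑(m x μ ν)) - (curlAt θ (x.shift lam) μ ν - 2 * Real.pi * ↑(m (x.shift lam) μ ν))|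
              + |curlAt θ x ν lam - 2 * Real.pi * ↑(m x ν lam)|) + φ₀) + φ₀) + φ₀ := by gcongr; exact abs_add_le _ _
      _ ≤ (((φ₀ + φ₀) + φ₀) + φ₀) + φ₀ + φ₀ := by linarith [t1, h3]
      _ = 6 * φ₀ := by ring
  have hlt : |2 * Real.pi * M| < 2 * Real.pi := hbound.trans_lt hφ
  rw [abs_mul, abs_of_pos (by positivity)] at hlt
  have : |M| < 1 := by
    by_contra hc
    push Not at hc
    have := mul_le_mul_of_nonneg_left hc (by positivity : (0 : ℝ) ≤ 2 * Real.pi)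
    linarith
  simpa [hM] using this

/-- **THE INTEGER PART IS ANTISYMMETRIC**: `|curl θ(x;μν) − 2πm(x;μν)|, |curl θ(x;νμ) − 2πm(x;νμ)| ≤ φ₀`, `2φ₀ < 2π` ⇒ `m(x;νμ) = −m(x;μν)`. [cite: Balaban1985Averaging, (9) p.19] -/
theorem int_antisymm_of_near_curl (θ : PBond P j → ℝ) (m : Site P j → Fin P.d → Fin P.d → ℤ) {φ₀ : ℝ} (hφ : 2 * φ₀ < 2 * Real.pi)
    (x : Site P j) (μ ν : Fin P.d) (h1 : |curlAt θ x μ ν - 2 * Real.pi * m x μ ν| ≤ φ₀) (h2 : |curlAt θ x ν μ - 2 * Real.pi * m x ν μ| ≤ φ₀) :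
    m x ν μ + m x μ ν = 0 := by
  have hs := curlAt_swap' θ x μ ν
  have hπ := Real.pi_pos
  apply int_eq_zero_of_abs_lt_one
  push_cast
  have key : 2 * Real.pi * ((m x ν μ : ℝ) + m x μ ν) = -((curlAt θ x ν μ - 2 * Real.pi * m x ν μ) + (curlAt θ x μ ν - 2 * Real.pi * m x μ ν)) := by
    rw [hs]; ring
  have hbound : |2 * Real.pi * ((m x ν μ : ℝ) + m x μ ν)| ≤ 2 * φ₀ := by
    rw [key, abs_neg]
    calc _ ≤ |curlAt θ x ν μ - 2 * Real.pi * ↑(m x ν μ)| + |curlAt θ x μ ν - 2 * Real.pi * ↑(m x μ ν)| := abs_add_le _ _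
      _ ≤ φ₀ + φ₀ := add_le_add h2 h1
      _ = 2 * φ₀ := by ring
  have hlt : |2 * Real.pi * ((m x ν μ : ℝ) + m x μ ν)| < 2 * Real.pi := hbound.trans_lt hφ
  rw [abs_mul, abs_of_pos (by positivity)] at hlt
  by_contra hc
  push Not at hc
  have := mul_le_mul_of_nonneg_left hc (by positivity : (0 : ℝ) ≤ 2 * Real.pi)
  linarith

/-- **THE INTEGER PART HAS ZERO DIAGONAL**: `|curl θ(x;μμ) − 2πm(x;μμ)| ≤ φ₀ < 2π` ⇒ `m(x;μμ) = 0` (`curl θ(x;μμ) = 0`). [cite: Balaban1985Averaging, (9) p.19] -/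
theorem int_diag_of_near_curl (θ : PBond P j → ℝ) (m : Site P j → Fin P.d → Fin P.d → ℤ) {φ₀ : ℝ} (hφ : φ₀ < 2 * Real.pi)
    (x : Site P j) (μ : Fin P.d) (h1 : |curlAt θ x μ μ - 2 * Real.pi * m x μ μ| ≤ φ₀) : m x μ μ = 0 := by
  have hs := curlAt_self θ x μ
  have hπ := Real.pi_pos
  apply int_eq_zero_of_abs_lt_one
  rw [hs, zero_sub, abs_neg, abs_mul, abs_of_pos (by positivity)] at h1
  by_contra hc
  push Not at hc
  have := mul_le_mul_of_nonneg_left hc (by positivity : (0 : ℝ) ≤ 2 * Real.pi)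
  linarith

end Summit.QuantumFields.YangMills.Theorems.LinearLiftFlux

end
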